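import Summits.BirchSwinnertonDyer.Rank1Residual.X11b.VisibilityRankOne
import Summits.BirchSwinnertonDyer.Rank1Residual.GaloisImage.FrobeniusOrderWitness
import Summits.BirchSwinnertonDyer.Rank1Residual.X11b.CertificateCheckBridge
import Summits.BirchSwinnertonDyer.Rank1Residual.GaloisImage.ThreeCongruenceHesseCertificateLemmas
import Literature.NumberTheory.EllipticCurves.Fisher2012.HesseFamilyThreeReverseProofs
import Summits.BirchSwinnertonDyer.Rank1Residual.Visibility.TwoWitnessLowerHalf262272u1
import Summits.BirchSwinnertonDyer.Rank1Residual.Visibility.TwoWitnessLowerHalf297696e1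
import Summits.BirchSwinnertonDyer.Rank1Residual.Visibility.TwoWitnessLowerHalf306629g1
import HarnessLib

/-!
# BSD rank-≤1 residual cell: rank-one TWO-WITNESS visibility compositions at `p = 3` (VIS-2W), file 3 — `262272u1` (X11b), `297696e1` (X11b), `306629g1` (X7)

HONEST FRAMING (cell `b2b-bsdres-*`, run/shared/lean/b2b/bsd-rank1-residual/, verbatim): the goal of the cell is to DELETE the
COMBINATION-SHAPED residual classes for ALL analytic-rank `≤ 1` elliptic curves over `ℚ` — "full BSD formula for every rank `≤ 1`
curve in class C" assembled STRICTLY from published theorems — so that the rank-`≤ 1` remainder becomes exactly the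
CONSTRUCTION-SHAPED classes, which are TYPED (missing-input Props), NOT attempted; this is not "finishing BSD". Prove what is
provable now; shrink each hard class to its core with data; no claim beyond stated classes. Unit `b2b-bsdres-x11c` GEN 34
(lit GEN 146 wake item (ii) «VIS-2W»). THEOREMS ONLY (no definition, no named fact introduced); PER PAIR (a certificate shape),
NOT a class theorem; classes X11b / X7 stay as labelled; nothing is booked by this file; the desk prices.

## What this file does

The x11c gen-4/6 rank-one visibility lever (`X11b.bsdp_of_kolyvagin_of_congr`, VIS30 `Visibility/RankOnePairs*`) needs ONE rank-`≥ 3`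
partner `E'` with `E'(ℚ_v)[3] = 0` at EVERY place of `S` — the binder that FAILS (`vis:loc-fails`, hyp ENGINE V `vis_rows.tsv`) on the
OPEN keys below. Team `bsd-addord` seat k1-c3 (gen 7) replaced that local condition by TWO explicit witnesses `T₁, T₂ ∈ E'(ℚ)`,
independent mod `3E'(ℚ)` and `3`-divisible (or harmless) at every place of `S` (doors p479804 / p488071, cell-free; kernel records
`missingLowerBoundAt_c<E>_3_of_congr`, re-homed here as `Visibility/TwoWitnessLowerHalf<E>.lean`) = the LOWER half
`ord₃ #Ш_an ≤ ord₃ #Ш`. This file COMPOSES, per key, that lower half BY NAME with Kolyvagin's UPPER half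
`ord₃ #Ш(E/ℚ) ≤ 2·ord₃ [E(K):ℤ y_K] ≤ 2` (`X11b.padicValNat_shaOrder_le_of_kolyvagin`: named facts `kolyvagin` (hKo) and
`Kolyvagin1990_padicValNat_card_sha_le` (hB) = McCallum 1991 §1 / Gross 1991 Thm 1.3, both PUBLISHED; the lane's Heegner datum
with `ord₃ [E(K):ℤP] ≤ 1` DISPLAYED as binders hK hH hP hnt hI) and `ρ̄_{E,3}` ONTO decided IN THE KERNEL (two Frobenius point counts,
`GaloisImage/FrobeniusOrderWitness`, or the landed `SecondDescent.surj3_s<E>` by name), into `bsdp_w<E> : … → θ → BSDp W 3` in the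
exact binder grammar of VIS30's `bsdp_v<label>` (hCT hGZK [hMR] W hW hKo hB hK hH hP hnt hI hr hs hv W' hW' θ hθ). The `3`-congruence
`θ : E'[3] ≃ E[3]` stays a DISPLAYED HYPOTHESIS TERM, certified outside the kernel by the Kraus–Oesterlé / Sturm bound with TWO engines
to the FULL bound (numbers per theorem). Nothing else is assumed: `E(ℚ)[3] = 0`, minimality, irreducibility, the local options of
the witnesses, independence and good reduction off `S` are kernel facts of the lower-half file.

References: [McCallumLMS1991] §1; [GrossLMS1991] Thm. 1.3; [CremonaMazur2000] §3; [AgasheStein2002] Lemma 3.6 / Thm. 3.1;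
[KrausOesterle1992] Prop. 4; [Serre1972] §2.4 Prop. 15; [MazurRubin2004] (Kolyvagin systems) resp. the tree's `selmerLocalKer_iff_of_goodReduction_above`
binder hMR where the key is good at `3`; [SilvermanAEC2009] X.4.14; [Miller2011LMS] Def. 1.1; [Cremona2006].
-/

set_option autoImplicit false

noncomputable section

open scoped Classical

open WeierstrassCurve Literature.NumberTheory.EllipticCurves
  Literature.NumberTheory.EllipticCurves.Rank1Residual
  Literature.NumberTheory.EllipticCurves.Rank1Residual.Typed
  Literature.NumberTheory.EllipticCurves.Rank1Residual.X11RankOneCertificates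
  Literature.NumberTheory.EllipticCurves.MazurRubin2015
  Literature.NumberTheory.EllipticCurves.Fisher2012
  Literature.NumberTheory.GaloisRepresentations
  Summit.BirchSwinnertonDyer.BirchSwinnertonDyer.Rank1Residual.IntModel
  Summit.BirchSwinnertonDyer.BirchSwinnertonDyer.Rank1Residual.X11RankOne
  Summit.BirchSwinnertonDyer.Rank1Residual.GaloisImage
  Summit.BirchSwinnertonDyer.Rank1Residual.X11b
open NumberField IsDedekindDomain

namespace Summit.BirchSwinnertonDyer.Rank1Residual.Visibility

/-! ### `262272u1 @ 3` (class X11b) — partner `262272m1` (rank 3) -/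

/-- `#Ẽ(𝔽₅) = 4` for Cremona's model `262272u1` (kernel point count on the integral model). [folklore] -/
theorem card_w262272u1_5 :
    Nat.card (((⟨0, 1, 0, -1822, -30550⟩ : WeierstrassCurve ℤ).map
      (Int.castRingHom (ZMod 5))).toAffine.Point) = 4 := by
  haveI : Fact (Nat.Prime 5) := ⟨by norm_num⟩
  have h := natCard_point_eq_countPoints 0 1 0 (-1822) (-30550) 5 (by norm_num) (by decide +kernel)
  have h' : countPoints [0, 1, 0, -1822, -30550] 5 = 4 := by decide +kernel
  exact_mod_cast h.trans h'

/-- `#Ẽ(𝔽₆₇) = 60` for Cremona's model `262272u1` (kernel point count on the integral model). [folklore] -/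
theorem card_w262272u1_67 :
    Nat.card (((⟨0, 1, 0, -1822, -30550⟩ : WeierstrassCurve ℤ).map
      (Int.castRingHom (ZMod 67))).toAffine.Point) = 60 := by
  haveI : Fact (Nat.Prime 67) := ⟨by norm_num⟩
  have h := natCard_point_eq_countPoints 0 1 0 (-1822) (-30550) 67 (by norm_num) (by decide +kernel)
  have h' : countPoints [0, 1, 0, -1822, -30550] 67 = 60 := by decide +kernel
  exact_mod_cast h.trans h'

/-- **`ρ̄_{E,3}` is onto for `262272u1`**, in the kernel (`GaloisImage/FrobeniusOrderWitness`): `ℓ₁ = 5` (`#Ẽ(𝔽₅) = 4`,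
`a = 2`: `X² − aX + 5` has no root mod `3`) and `ℓ₂ = 67` (`67 ≡ 1 (mod 3)`, `#Ẽ(𝔽₆₇) = 60`, `a = 8 ≡ 2 (mod 3)`, `9 ∤ 60`:
a Frobenius of ORDER `3` on `E[3]`), for any globally minimal elliptic `W/ℚ` with this integral model. Readings outside the kernel agree
(Cremona/Sutherland `galrep`: no `3`-adic image label; hyp ENGINE V surj(3) G/A/B = 1/1/1). [cite: Serre1972, §2.4 Prop. 15] -/
theorem surj3_w262272u1 {W : WeierstrassCurve ℚ} [W.IsElliptic] [W.IsGloballyMinimal]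
    (hI : integralModelInt W = ⟨0, 1, 0, -1822, -30550⟩) : W.HasSurjectiveModNGaloisRep 3 :=
  @hasSurjectiveModNGaloisRep_of_intModel_of_irr_of_order W _ _ _ hI 3 ⟨by norm_num⟩ 5 67 ⟨by norm_num⟩
    ⟨by norm_num⟩ (by norm_num) (by norm_num) (by decide +kernel) (by decide +kernel) _ _
    card_w262272u1_5 card_w262272u1_67 (by decide) (by decide) (by decide) (by decide)

/-- **`BSD(E,3)` for `262272u1`** (class X11b; `N = 262272 = 2⁷·3·683`; at `3`: split multiplicative `I₂` (`c₃ = 2`), additive at `2`, `I₁` at `683`; `ρ̄_{E,3}` onto; `r_an = 1`; `#E(ℚ)_tors = 2`;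
`∏ c_q = 2`; `#Ш_an = 9`; other members of the isogeny class by `bsdp_iff_of_isIsogenous`) from PUBLISHED theorems — Kolyvagin's index
bound (`hKo`, `hB`: McCallum 1991 §1 / Gross 1991 Thm. 1.3), Cassels–Tate (`hCT`), Gross–Zagier–Kolyvagin (`hGZK`) — plus the
per-pair certificates: UPPER half = the lane's Heegner datum `K = ℚ(√-23)`, `[E(K):ℤy_K] = m = 6`, `ord₃ m = 1` (bsdN-sweep/0.1.2,
certified `4ρ`-ball; second field `D = -47`, `m = 12`; hyp ENGINE V `idx` T-KOLY `ord₃ m ≤ 1`), DISPLAYED as hK hH hP hnt hI; LOWER half =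
k1-c3 g7's two-witness KERNEL record `missingLowerBoundAt_c262272u1_3_of_congr` (`Visibility/TwoWitnessLowerHalf262272u1.lean`: partner
`W' = 262272m1` of rank `3`, witnesses `T₁, T₂ ∈ W'(ℚ)` independent mod `3W'(ℚ)` and locally `3`-divisible / harmless on `S = {2, 3, 683}`,
`E[3]` irreducible, minimality, good reduction off `S` — all in the kernel) BY NAME, with the `3`-CONGRUENCE `θ : W'[3] ≃ E[3]` DISPLAYED
(certified outside the kernel: Kraus–Oesterlé `a_ℓ(E) ≡ a_ℓ(W') (mod 3)` for every `ℓ ≤ B = 87551` (`M = 262272`), TWO engines to the FULL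
bound, hyp ENGINE V-A (python) / V-B (PARI 2.17.2), jobs j082351–j083043, `vis_triples.tsv.gz` row (262272u1, 3, 262272m1): `H_cong = 1` agree, `cong_full_two_engine = True`); `ρ̄_{E,3}` onto by `surj3_w262272u1` (this file). Composition = `X11b.padicValNat_shaOrder_le_of_kolyvagin` +
`X11b.missingUpperBoundAt_of_padicValNat_shaOrder_le` + `bsdp_of_missingPPartAt`. Per pair; the lane / referee A book the verdict;
no label change; nothing booked here. [cite: McCallumLMS1991, §1 Theorem (Kolyvagin), p. 296] [cite: GrossLMS1991, Thm. 1.3]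
[cite: CremonaMazur2000, §3 and Table 1] [cite: AgasheStein2002, Lemma 3.6] [cite: KrausOesterle1992, Prop. 4]
[cite: Miller2011LMS, §1 and Def. 1.1] [cite: Cremona2006, Table 1 (262272u1, 262272m1)] -/
theorem bsdp_w262272u1 (hCT : exists_casselsTate_pairing (K := ℚ))
    (hGZK : rank_eq_analyticRank_of_analyticRank_le_one)
    (W : WeierstrassCurve ℚ) (hW : W = ⟨0, 1, 0, -1822, -30550⟩)
    {N : ℕ} [NeZero N] {K : Type} [Field K] [NumberField K] (hKo : kolyvagin N W K)
    (hB : Kolyvagin1990_padicValNat_card_sha_le N W K) (hK : IsImaginaryQuadratic K)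
    (hH : SatisfiesHeegnerHypothesis N K) {P : (W.baseChange K).toAffine.Point}
    (hP : IsHeegnerPoint N W K P) (hnt : ¬ IsOfFinAddOrder P)
    (hI : padicValNat 3 (AddSubgroup.zmultiples P).index ≤ 1)
    (hr : W.analyticRank = 1) {s : ℚ} (hs : shaAn W = (s : ℂ)) (hv : padicValRat 3 s = 2)
    (W' : WeierstrassCurve ℚ) (hW' : W' = ⟨0, 1, 0, -15145, 710759⟩)
    (θ : geomTorsion W' (3 : ℤ) ≃+ geomTorsion W (3 : ℤ))
    (hθ : ∀ (σ : Field.absoluteGaloisGroup ℚ) (Q : geomTorsion W' (3 : ℤ)), θ (σ • Q) = σ • θ Q) :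
    BSDp W 3 := by
  haveI : Fact (Nat.Prime 3) := ⟨by norm_num⟩
  subst hW hW'
  haveI := isElliptic_c262272u1
  haveI := isGloballyMinimal_c262272u1
  haveI := Summit.BirchSwinnertonDyer.BirchSwinnertonDyer.Rank2Observatory.C262272m1.isElliptic
  haveI := isGloballyMinimal_c262272m1
  obtain ⟨-, hfin⟩ := hGZK (⟨0, 1, 0, -1822, -30550⟩ : WeierstrassCurve ℚ) (by omega)
  have hρ : (⟨0, 1, 0, -1822, -30550⟩ : WeierstrassCurve ℚ).HasSurjectiveModNGaloisRep 3 :=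
    surj3_w262272u1 (integralModelInt_eq_of_map_eq _ (map_mk_int 0 1 0 (-1822) (-30550)))
  -- LOWER half: k1-c3's two-witness kernel record, by name
  have hlow : MissingLowerBoundAt (⟨0, 1, 0, -1822, -30550⟩ : WeierstrassCurve ℚ) 3 :=
    missingLowerBoundAt_c262272u1_3_of_congr hCT hGZK rfl rfl hr hs hv.le θ hθ
  -- UPPER half: Kolyvagin at the displayed Heegner datum
  have hup : MissingUpperBoundAt (⟨0, 1, 0, -1822, -30550⟩ : WeierstrassCurve ℚ) 3 :=
    X11b.missingUpperBoundAt_of_padicValNat_shaOrder_le _ 3 (k := 1)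
      (X11b.padicValNat_shaOrder_le_of_kolyvagin _ 3 hKo hB hK hH hP hnt (by norm_num) hρ hfin hI) hs
      (by rw [hv]; norm_num)
  exact bsdp_of_missingPPartAt _ 3 hGZK (by omega) (missingPPartAt_of_lower_of_upper _ 3 hlow hup)

/-- **`bsdp_w262272u1` with θ/hθ DISCHARGED IN THE KERNEL** (HESSE GRADE, the n1011 ROW T-VIS3-TH twin pattern of VIS30's
`bsdpHesse_v<label>`): the partner `262272m1` is `ℚ`-isomorphic to the member `(l : m) = (-300 : 1)` (`u = 4`) of the DIRECT (`X_E(3)`)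
Hesse pencil of `E` (Fisher 2012 Thm. 13.2, `n = 3`; unconditional: `threeCongruent_of_hesseCertificate_unconditional`; certificate found by n1011's
`tvis3_hesse3_search.py` (f7173afc…) run by this unit, complete rational-root search of the degree-12 `j`-equation), so
`θ : W'[3] ≃ E[3]` comes from ONE call of `VisCerts.torsionIso3_of_hesseCert_mk` with ten `norm_num` identities. Remaining binders:
hCT hGZK W hW hKo hB hK hH hP hnt hI hr hs hv ⊢ `BSDp W 3` — NO θ, NO partner datum, NO local-torsion binder. Per pair; nothing booked.
[cite: Fisher2012Hessian, Thm. 13.2 (n = 3)] [cite: CremonaAlgorithms1997, §3.5] -/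
theorem bsdpHesse_w262272u1 (hCT : exists_casselsTate_pairing (K := ℚ))
    (hGZK : rank_eq_analyticRank_of_analyticRank_le_one)
    (W : WeierstrassCurve ℚ) (hW : W = ⟨0, 1, 0, -1822, -30550⟩)
    {N : ℕ} [NeZero N] {K : Type} [Field K] [NumberField K] (hKo : kolyvagin N W K)
    (hB : Kolyvagin1990_padicValNat_card_sha_le N W K) (hK : IsImaginaryQuadratic K)
    (hH : SatisfiesHeegnerHypothesis N K) {P : (W.baseChange K).toAffine.Point}
    (hP : IsHeegnerPoint N W K P) (hnt : ¬ IsOfFinAddOrder P)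
    (hI : padicValNat 3 (AddSubgroup.zmultiples P).index ≤ 1)
    (hr : W.analyticRank = 1) {s : ℚ} (hs : shaAn W = (s : ℂ)) (hv : padicValRat 3 s = 2) :
    BSDp W 3 := by
  haveI : (⟨0, 1, 0, -15145, 710759⟩ : WeierstrassCurve ℚ).IsElliptic := Summit.BirchSwinnertonDyer.BirchSwinnertonDyer.Rank2Observatory.C262272m1.isElliptic
  have hWlit : W = ⟨0, 1, 0, -1822, -30550⟩ := hW
  haveI : W.IsElliptic := by rw [hWlit]; exact isElliptic_c262272u1
  obtain ⟨θ, hθ⟩ := VisCerts.torsionIso3_of_hesseCert_mk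
    (W' := (⟨0, 1, 0, -15145, 710759⟩ : WeierstrassCurve ℚ)) hWlit rfl
    87472 25870400 726976 (-618457600) (by norm_num) (by norm_num) (by norm_num) (by norm_num)
    (-300) 1 4 (by norm_num) (by norm_num) (by norm_num)
  exact bsdp_w262272u1 hCT hGZK W hW hKo hB hK hH hP hnt hI hr hs hv _ rfl θ hθ

/-! ### `297696e1 @ 3` (class X11b) — partner `42528c1` (rank 3) -/

/-- `#Ẽ(𝔽₅) = 4` for Cremona's model `297696e1` (kernel point count on the integral model). [folklore] -/
theorem card_w297696e1_5 :
    Nat.card (((⟨0, -1, 0, -120982, 7809520⟩ : WeierstrassCurve ℤ).map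
      (Int.castRingHom (ZMod 5))).toAffine.Point) = 4 := by
  haveI : Fact (Nat.Prime 5) := ⟨by norm_num⟩
  have h := natCard_point_eq_countPoints 0 (-1) 0 (-120982) 7809520 5 (by norm_num) (by decide +kernel)
  have h' : countPoints [0, -1, 0, -120982, 7809520] 5 = 4 := by decide +kernel
  exact_mod_cast h.trans h'

/-- `#Ẽ(𝔽₁₉) = 24` for Cremona's model `297696e1` (kernel point count on the integral model). [folklore] -/
theorem card_w297696e1_19 :
    Nat.card (((⟨0, -1, 0, -120982, 7809520⟩ : WeierstrassCurve ℤ).map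
      (Int.castRingHom (ZMod 19))).toAffine.Point) = 24 := by
  haveI : Fact (Nat.Prime 19) := ⟨by norm_num⟩
  have h := natCard_point_eq_countPoints 0 (-1) 0 (-120982) 7809520 19 (by norm_num) (by decide +kernel)
  have h' : countPoints [0, -1, 0, -120982, 7809520] 19 = 24 := by decide +kernel
  exact_mod_cast h.trans h'

/-- **`ρ̄_{E,3}` is onto for `297696e1`**, in the kernel (`GaloisImage/FrobeniusOrderWitness`): `ℓ₁ = 5` (`#Ẽ(𝔽₅) = 4`,
`a = 2`: `X² − aX + 5` has no root mod `3`) and `ℓ₂ = 19` (`19 ≡ 1 (mod 3)`, `#Ẽ(𝔽₁₉) = 24`, `a = -4 ≡ 2 (mod 3)`, `9 ∤ 24`: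
a Frobenius of ORDER `3` on `E[3]`), for any globally minimal elliptic `W/ℚ` with this integral model. Readings outside the kernel agree
(Cremona/Sutherland `galrep`: no `3`-adic image label; hyp ENGINE V surj(3) G/A/B = 1/1/1). [cite: Serre1972, §2.4 Prop. 15] -/
theorem surj3_w297696e1 {W : WeierstrassCurve ℚ} [W.IsElliptic] [W.IsGloballyMinimal]
    (hI : integralModelInt W = ⟨0, -1, 0, -120982, 7809520⟩) : W.HasSurjectiveModNGaloisRep 3 :=
  @hasSurjectiveModNGaloisRep_of_intModel_of_irr_of_order W _ _ _ hI 3 ⟨by norm_num⟩ 5 19 ⟨by norm_num⟩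
    ⟨by norm_num⟩ (by norm_num) (by norm_num) (by decide +kernel) (by decide +kernel) _ _
    card_w297696e1_5 card_w297696e1_19 (by decide) (by decide) (by decide) (by decide)

/-- **`BSD(E,3)` for `297696e1`** (class X11b; `N = 297696 = 2⁵·3·7·443`; at `3`: non-split multiplicative `I₁₀` (`c₃ = 2`), additive at `2`, `I₆` at `7`, `I₂` at `443`; `ρ̄_{E,3}` onto; `r_an = 1`; `#E(ℚ)_tors = 4`;
`∏ c_q = 16`; `#Ш_an = 9`; other members of the isogeny class by `bsdp_iff_of_isIsogenous`) from PUBLISHED theorems — Kolyvagin's index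
bound (`hKo`, `hB`: McCallum 1991 §1 / Gross 1991 Thm. 1.3), Cassels–Tate (`hCT`), Gross–Zagier–Kolyvagin (`hGZK`) — plus the
per-pair certificates: UPPER half = the lane's Heegner datum `K = ℚ(√-503)`, `[E(K):ℤy_K] = m = 24`, `ord₃ m = 1` (bsdN-sweep/0.1.2,
certified `4ρ`-ball; second field `D = -671`, `m = 144`; hyp ENGINE V `idx` T-KOLY `ord₃ m ≤ 1`), DISPLAYED as hK hH hP hnt hI; LOWER half =
k1-c3 g7's two-witness KERNEL record `missingLowerBoundAt_c297696e1_3_of_congr` (`Visibility/TwoWitnessLowerHalf297696e1.lean`: partner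
`W' = 42528c1` of rank `3`, witnesses `T₁, T₂ ∈ W'(ℚ)` independent mod `3W'(ℚ)` and locally `3`-divisible / harmless on `S = {2, 3, 7, 443}`,
`E[3]` irreducible, minimality, good reduction off `S` — all in the kernel) BY NAME, with the `3`-CONGRUENCE `θ : W'[3] ≃ E[3]` DISPLAYED
(certified outside the kernel: Kraus–Oesterlé `a_ℓ(E) ≡ a_ℓ(W') (mod 3)` for every `ℓ ≤ B = 113663` (`M = 297696`), TWO engines to the FULL
bound, hyp ENGINE V-A (python) / V-B (PARI 2.17.2), jobs j082351–j083043, `vis_triples.tsv.gz` row (297696e1, 3, 42528c1): `H_cong = 1` agree, `cong_full_two_engine = True`); `ρ̄_{E,3}` onto by `surj3_w297696e1` (this file). Composition = `X11b.padicValNat_shaOrder_le_of_kolyvagin` +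
`X11b.missingUpperBoundAt_of_padicValNat_shaOrder_le` + `bsdp_of_missingPPartAt`. Per pair; the lane / referee A book the verdict;
no label change; nothing booked here. [cite: McCallumLMS1991, §1 Theorem (Kolyvagin), p. 296] [cite: GrossLMS1991, Thm. 1.3]
[cite: CremonaMazur2000, §3 and Table 1] [cite: AgasheStein2002, Lemma 3.6] [cite: KrausOesterle1992, Prop. 4]
[cite: Miller2011LMS, §1 and Def. 1.1] [cite: Cremona2006, Table 1 (297696e1, 42528c1)] -/
theorem bsdp_w297696e1 (hCT : exists_casselsTate_pairing (K := ℚ))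
    (hGZK : rank_eq_analyticRank_of_analyticRank_le_one)
    (W : WeierstrassCurve ℚ) (hW : W = ⟨0, -1, 0, -120982, 7809520⟩)
    {N : ℕ} [NeZero N] {K : Type} [Field K] [NumberField K] (hKo : kolyvagin N W K)
    (hB : Kolyvagin1990_padicValNat_card_sha_le N W K) (hK : IsImaginaryQuadratic K)
    (hH : SatisfiesHeegnerHypothesis N K) {P : (W.baseChange K).toAffine.Point}
    (hP : IsHeegnerPoint N W K P) (hnt : ¬ IsOfFinAddOrder P)
    (hI : padicValNat 3 (AddSubgroup.zmultiples P).index ≤ 1)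
    (hr : W.analyticRank = 1) {s : ℚ} (hs : shaAn W = (s : ℂ)) (hv : padicValRat 3 s = 2)
    (W' : WeierstrassCurve ℚ) (hW' : W' = ⟨0, -1, 0, -65, 81⟩)
    (θ : geomTorsion W' (3 : ℤ) ≃+ geomTorsion W (3 : ℤ))
    (hθ : ∀ (σ : Field.absoluteGaloisGroup ℚ) (Q : geomTorsion W' (3 : ℤ)), θ (σ • Q) = σ • θ Q) :
    BSDp W 3 := by
  haveI : Fact (Nat.Prime 3) := ⟨by norm_num⟩
  subst hW hW'
  haveI := isElliptic_c297696e1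
  haveI := isGloballyMinimal_c297696e1
  haveI := isElliptic_c42528c1
  haveI := isGloballyMinimal_c42528c1
  obtain ⟨-, hfin⟩ := hGZK (⟨0, -1, 0, -120982, 7809520⟩ : WeierstrassCurve ℚ) (by omega)
  have hρ : (⟨0, -1, 0, -120982, 7809520⟩ : WeierstrassCurve ℚ).HasSurjectiveModNGaloisRep 3 :=
    surj3_w297696e1 (integralModelInt_eq_of_map_eq _ (map_mk_int 0 (-1) 0 (-120982) 7809520))
  -- LOWER half: k1-c3's two-witness kernel record, by name
  have hlow : MissingLowerBoundAt (⟨0, -1, 0, -120982, 7809520⟩ : WeierstrassCurve ℚ) 3 :=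
    missingLowerBoundAt_c297696e1_3_of_congr hCT hGZK rfl rfl hr hs hv.le θ hθ
  -- UPPER half: Kolyvagin at the displayed Heegner datum
  have hup : MissingUpperBoundAt (⟨0, -1, 0, -120982, 7809520⟩ : WeierstrassCurve ℚ) 3 :=
    X11b.missingUpperBoundAt_of_padicValNat_shaOrder_le _ 3 (k := 1)
      (X11b.padicValNat_shaOrder_le_of_kolyvagin _ 3 hKo hB hK hH hP hnt (by norm_num) hρ hfin hI) hs
      (by rw [hv]; norm_num)
  exact bsdp_of_missingPPartAt _ 3 hGZK (by omega) (missingPPartAt_of_lower_of_upper _ 3 hlow hup)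

/-- **`bsdp_w297696e1` with θ/hθ DISCHARGED IN THE KERNEL** (HESSE GRADE, the n1011 ROW T-VIS3-TH twin pattern of VIS30's
`bsdpHesse_v<label>`): the partner `42528c1` is `ℚ`-isomorphic to the member `(l : m) = (800 : 1)` (`u = 1 / 392`) of the DUAL (`X_E⁻(3)`)
Hesse pencil of `E` (Fisher 2012 Thm. 13.2, `n = 3`; the tree THEOREM `Fisher2012.thm132rev_threeCongruent_dualHessePencil_holds` (A243 discharged); certificate found by n1011's
`tvis3_hesse3_search.py` (f7173afc…) run by this unit, complete rational-root search of the degree-12 `j`-equation), so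
`θ : W'[3] ≃ E[3]` comes from ONE call of `VisCerts.torsionIso3_of_dualHesseCert_mk` with ten `norm_num` identities. Remaining binders:
hCT hGZK W hW hKo hB hK hH hP hnt hI hr hs hv ⊢ `BSDp W 3` — NO θ, NO partner datum, NO local-torsion binder. Per pair; nothing booked.
[cite: Fisher2012Hessian, Thm. 13.2 (n = 3)] [cite: CremonaAlgorithms1997, §3.5] -/
theorem bsdpHesse_w297696e1 (hCT : exists_casselsTate_pairing (K := ℚ))
    (hGZK : rank_eq_analyticRank_of_analyticRank_le_one)
    (W : WeierstrassCurve ℚ) (hW : W = ⟨0, -1, 0, -120982, 7809520⟩)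
    {N : ℕ} [NeZero N] {K : Type} [Field K] [NumberField K] (hKo : kolyvagin N W K)
    (hB : Kolyvagin1990_padicValNat_card_sha_le N W K) (hK : IsImaginaryQuadratic K)
    (hH : SatisfiesHeegnerHypothesis N K) {P : (W.baseChange K).toAffine.Point}
    (hP : IsHeegnerPoint N W K P) (hnt : ¬ IsOfFinAddOrder P)
    (hI : padicValNat 3 (AddSubgroup.zmultiples P).index ≤ 1)
    (hr : W.analyticRank = 1) {s : ℚ} (hs : shaAn W = (s : ℂ)) (hv : padicValRat 3 s = 2) :
    BSDp W 3 := by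
  haveI : (⟨0, -1, 0, -65, 81⟩ : WeierstrassCurve ℚ).IsElliptic := isElliptic_c42528c1
  have hWlit : W = ⟨0, -1, 0, -120982, 7809520⟩ := hW
  haveI : W.IsElliptic := by rw [hWlit]; exact isElliptic_c297696e1
  obtain ⟨θ, hθ⟩ := VisCerts.torsionIso3_of_dualHesseCert_mk thm132rev_threeCongruent_dualHessePencil_holds
    (W' := (⟨0, -1, 0, -65, 81⟩ : WeierstrassCurve ℚ)) hWlit rfl
    5807152 (-6712582400) 3136 (-51200) (by norm_num) (by norm_num) (by norm_num) (by norm_num)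
    800 1 (1 / 392 : ℚ) (by norm_num) (by norm_num) (by norm_num)
  exact bsdp_w297696e1 hCT hGZK W hW hKo hB hK hH hP hnt hI hr hs hv _ rfl θ hθ

/-! ### `306629g1 @ 3` (class X7) — partner `306629b1` (rank 3) -/

/-- **`BSD(E,3)` for `306629g1`** (class X7; `N = 306629 = 17²·1061`; at `3`: good supersingular (`a₃ = 0`), additive `I₅*` at `17`, `I₁` at `1061`; `ρ̄_{E,3}` onto; `r_an = 1`; `#E(ℚ)_tors = 1`;
`∏ c_q = 4`; `#Ш_an = 9`; other members of the isogeny class by `bsdp_iff_of_isIsogenous`) from PUBLISHED theorems — Kolyvagin's index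
bound (`hKo`, `hB`: McCallum 1991 §1 / Gross 1991 Thm. 1.3), Cassels–Tate (`hCT`), Gross–Zagier–Kolyvagin (`hGZK`), Mazur–Rubin (`hMR`, place `3` free: both curves GOOD at `3`) — plus the
per-pair certificates: UPPER half = the lane's Heegner datum `K = ℚ(√-19)`, `[E(K):ℤy_K] = m = 24`, `ord₃ m = 1` (bsdN-sweep/0.1.2,
certified `4ρ`-ball; second field `D = -47`, `m = 72`; hyp ENGINE V `idx` T-KOLY `ord₃ m ≤ 1`), DISPLAYED as hK hH hP hnt hI; LOWER half =
k1-c3 g7's two-witness KERNEL record `missingLowerBoundAt_c306629g1_3_of_congr` (`Visibility/TwoWitnessLowerHalf306629g1.lean`: partner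
`W' = 306629b1` of rank `3`, witnesses `T₁, T₂ ∈ W'(ℚ)` independent mod `3W'(ℚ)` and locally `3`-divisible / harmless on `S = {3, 17, 1061}`,
`E[3]` irreducible, minimality, good reduction off `S` — all in the kernel) BY NAME, with the `3`-CONGRUENCE `θ : W'[3] ≃ E[3]` DISPLAYED
(certified outside the kernel: Kraus–Oesterlé `a_ℓ(E) ≡ a_ℓ(W') (mod 3)` for every `ℓ ≤ B = 54161` (`M = 306629`), TWO engines to the FULL
bound, hyp ENGINE V-A (python) / V-B (PARI 2.17.2), jobs j082351–j083043, `vis_triples.tsv.gz` row (306629g1, 3, 306629b1): `H_cong = 1` agree, `cong_full_two_engine = True`); `ρ̄_{E,3}` onto by `SecondDescent.surj3_s306629g1` (landed, by name). Composition = `X11b.padicValNat_shaOrder_le_of_kolyvagin` +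
`X11b.missingUpperBoundAt_of_padicValNat_shaOrder_le` + `bsdp_of_missingPPartAt`. Per pair; the lane / referee A book the verdict;
no label change; nothing booked here. [cite: McCallumLMS1991, §1 Theorem (Kolyvagin), p. 296] [cite: GrossLMS1991, Thm. 1.3]
[cite: CremonaMazur2000, §3 and Table 1] [cite: AgasheStein2002, Lemma 3.6] [cite: KrausOesterle1992, Prop. 4]
[cite: Miller2011LMS, §1 and Def. 1.1] [cite: Cremona2006, Table 1 (306629g1, 306629b1)] -/
theorem bsdp_w306629g1 (hCT : exists_casselsTate_pairing (K := ℚ))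
    (hGZK : rank_eq_analyticRank_of_analyticRank_le_one)
    (hMR : selmerLocalKer_iff_of_goodReduction_above)
    (W : WeierstrassCurve ℚ) (hW : W = ⟨1, -1, 0, -2352803, -1388519714⟩)
    {N : ℕ} [NeZero N] {K : Type} [Field K] [NumberField K] (hKo : kolyvagin N W K)
    (hB : Kolyvagin1990_padicValNat_card_sha_le N W K) (hK : IsImaginaryQuadratic K)
    (hH : SatisfiesHeegnerHypothesis N K) {P : (W.baseChange K).toAffine.Point}
    (hP : IsHeegnerPoint N W K P) (hnt : ¬ IsOfFinAddOrder P)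
    (hI : padicValNat 3 (AddSubgroup.zmultiples P).index ≤ 1)
    (hr : W.analyticRank = 1) {s : ℚ} (hs : shaAn W = (s : ℂ)) (hv : padicValRat 3 s = 2)
    (W' : WeierstrassCurve ℚ) (hW' : W' = ⟨0, 0, 1, -17, 4⟩)
    (θ : geomTorsion W' (3 : ℤ) ≃+ geomTorsion W (3 : ℤ))
    (hθ : ∀ (σ : Field.absoluteGaloisGroup ℚ) (Q : geomTorsion W' (3 : ℤ)), θ (σ • Q) = σ • θ Q) :
    BSDp W 3 := by
  haveI : Fact (Nat.Prime 3) := ⟨by norm_num⟩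
  subst hW hW'
  haveI := isElliptic_c306629g1
  haveI := SecondDescent.isGloballyMinimal_s306629g1
  haveI := isElliptic_c306629b1
  haveI := isGloballyMinimal_c306629b1
  obtain ⟨-, hfin⟩ := hGZK (⟨1, -1, 0, -2352803, -1388519714⟩ : WeierstrassCurve ℚ) (by omega)
  have hρ : (⟨1, -1, 0, -2352803, -1388519714⟩ : WeierstrassCurve ℚ).HasSurjectiveModNGaloisRep 3 :=
    SecondDescent.surj3_s306629g1
  -- LOWER half: k1-c3's two-witness kernel record, by name
  have hlow : MissingLowerBoundAt (⟨1, -1, 0, -2352803, -1388519714⟩ : WeierstrassCurve ℚ) 3 :=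
    missingLowerBoundAt_c306629g1_3_of_congr hCT hGZK hMR rfl rfl hr hs hv.le θ hθ
  -- UPPER half: Kolyvagin at the displayed Heegner datum
  have hup : MissingUpperBoundAt (⟨1, -1, 0, -2352803, -1388519714⟩ : WeierstrassCurve ℚ) 3 :=
    X11b.missingUpperBoundAt_of_padicValNat_shaOrder_le _ 3 (k := 1)
      (X11b.padicValNat_shaOrder_le_of_kolyvagin _ 3 hKo hB hK hH hP hnt (by norm_num) hρ hfin hI) hs
      (by rw [hv]; norm_num)
  exact bsdp_of_missingPPartAt _ 3 hGZK (by omega) (missingPPartAt_of_lower_of_upper _ 3 hlow hup)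

/-- **`bsdp_w306629g1` with θ/hθ DISCHARGED IN THE KERNEL** (HESSE GRADE, the n1011 ROW T-VIS3-TH twin pattern of VIS30's
`bsdpHesse_v<label>`): the partner `306629b1` is `ℚ`-isomorphic to the member `(l : m) = (-9707 : 1)` (`u = 19652`) of the DIRECT (`X_E(3)`)
Hesse pencil of `E` (Fisher 2012 Thm. 13.2, `n = 3`; unconditional: `threeCongruent_of_hesseCertificate_unconditional`; certificate found by n1011's
`tvis3_hesse3_search.py` (f7173afc…) run by this unit, complete rational-root search of the degree-12 `j`-equation), so
`θ : W'[3] ≃ E[3]` comes from ONE call of `VisCerts.torsionIso3_of_hesseCert_mk` with ten `norm_num` identities. Remaining binders: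
hCT hGZK hMR W hW hKo hB hK hH hP hnt hI hr hs hv ⊢ `BSDp W 3` — NO θ, NO partner datum, NO local-torsion binder. Per pair; nothing booked.
[cite: Fisher2012Hessian, Thm. 13.2 (n = 3)] [cite: CremonaAlgorithms1997, §3.5] -/
theorem bsdpHesse_w306629g1 (hCT : exists_casselsTate_pairing (K := ℚ))
    (hGZK : rank_eq_analyticRank_of_analyticRank_le_one)
    (hMR : selmerLocalKer_iff_of_goodReduction_above)
    (W : WeierstrassCurve ℚ) (hW : W = ⟨1, -1, 0, -2352803, -1388519714⟩)
    {N : ℕ} [NeZero N] {K : Type} [Field K] [NumberField K] (hKo : kolyvagin N W K)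
    (hB : Kolyvagin1990_padicValNat_card_sha_le N W K) (hK : IsImaginaryQuadratic K)
    (hH : SatisfiesHeegnerHypothesis N K) {P : (W.baseChange K).toAffine.Point}
    (hP : IsHeegnerPoint N W K P) (hnt : ¬ IsOfFinAddOrder P)
    (hI : padicValNat 3 (AddSubgroup.zmultiples P).index ≤ 1)
    (hr : W.analyticRank = 1) {s : ℚ} (hs : shaAn W = (s : ℂ)) (hv : padicValRat 3 s = 2) :
    BSDp W 3 := by
  haveI : (⟨0, 0, 1, -17, 4⟩ : WeierstrassCurve ℚ).IsElliptic := isElliptic_c306629b1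
  have hWlit : W = ⟨1, -1, 0, -2352803, -1388519714⟩ := hW
  haveI : W.IsElliptic := by rw [hWlit]; exact isElliptic_c306629g1
  obtain ⟨θ, hθ⟩ := VisCerts.torsionIso3_of_hesseCert_mk
    (W' := (⟨0, 0, 1, -17, 4⟩ : WeierstrassCurve ℚ)) hWlit rfl
    112934553 1200189238371 816 (-3672) (by norm_num) (by norm_num) (by norm_num) (by norm_num)
    (-9707) 1 19652 (by norm_num) (by norm_num) (by norm_num)
  exact bsdp_w306629g1 hCT hGZK hMR W hW hKo hB hK hH hP hnt hI hr hs hv _ rfl θ hθ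

end Summit.BirchSwinnertonDyer.Rank1Residual.Visibility

end
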